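import Literature.AlgebraicGeometry.Frobenioids.Categories
import Literature.NumberTheory.GaloisRepresentations.AbsGaloisGroup
import Literature.FieldTheory.Galois.RootOfUnityTwistedEndomorphism
import Mathlib.FieldTheory.Galois.Infinite
import Mathlib.NumberTheory.Cyclotomic.CyclotomicCharacter
import HarnessLib

/-!
# Slimness of `G_K` from "infinitely divisible ⟹ torsion" on finite extensions
# (Kummer engine for [Tpcs] Lemma 4.14, class-field-theory-free)

S. Mochizuki, *Topics surrounding the anabelian geometry of hyperbolic curves*, MSRI Publ. 41
(2003) [Tpcs], Lemma 4.14 p. 48: "Let `K` be generalized sub-`p`-adic. Then `Γ_K` is center-free"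
(typed as `Tpcs.Lem_4_14` in `RelativeGrothendieckConjecture.lean`).  The printed proof goes through
the relative Grothendieck Conjecture ([Tpcs] Thm 4.12); this proof-only file isolates an ELEMENTARY
engine, a variant of the tree's `isSlimGroup_absoluteGaloisGroup_of_isTorallyKummerFaithful`
(`SlimOfTorallyKummerFaithfulProofs.lean`, [AbsAnab] Thm 1.1.1 (ii)) in which

* toral Kummer-faithfulness (`⋂_N (M^×)^N = 1` for all finite `M/K`) is WEAKENED to
  "every infinitely divisible unit of a finite extension `M/K` has finite order" (true for
  generalized sub-`p`-adic fields, false in the Kummer-faithful sense: Teichmüller roots of unity of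
  `W(𝔽̄_p)` are infinitely divisible, [AbsTopIII] Rmk 1.5.4 (iv)), and
* the valuation `v : K^× → ℤ` is replaced by a homomorphism `M^× → ℤ` on EACH finite `M/K` not
  killing a fixed `a₀ ∈ K^×` (so no norm `N_{M/K}` is needed).

`isSlimGroup_absoluteGaloisGroup_of_divisible_isOfFinOrder`: under these two hypotheses
`Gal(K̄/K)` is slim.  Proof: for `σ` centralising `Gal(K̄/E₀)` and `x ∈ K̄`, `M := E₀(x)`,
Kummer theory gives `σ(a) = βⁿ a^m` on `M^×` (`β ∈ M`, `σζ = ζ^m` on `μ_n`); at `a = a₀` the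
homomorphism `M^× → ℤ` forces `N ∣ m - 1` for `n = N·|v(a₀)|`, whence `σ(x)/x ∈ ⋂_N (M^×)^N` is
of finite order: `σ(x)^k = x^k`.  The cyclotomic additive trick
(`Literature.FieldTheory.Galois.eq_self_of_forall_pow_eq`) then gives `σ = 1`.
Proof-only: no definitions. [cite: MochizukiTopics2003, Lem 4.14 p.48]
-/

noncomputable section

open scoped Classical IntermediateField

namespace Literature.AnabelianGeometry.AbsoluteAnabelian

open Field IntermediateField
open Literature.AlgebraicGeometry.Frobenioids (IsSlimGroup)

universe u

section General

variable {K : Type u} [Field K] [CharZero K]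

/-- Infinite Galois theory for `K̄/K` (`char K = 0`): an open subgroup of `Gal(K̄/K)` is `Gal(K̄/E)`
for a finite subextension `E`. [folklore] -/
private theorem exists_intermediateField_of_isOpen_dt (N : Subgroup (absoluteGaloisGroup K))
    (hN : IsOpen (N : Set (absoluteGaloisGroup K))) :
    ∃ E : IntermediateField K (AlgebraicClosure K), FiniteDimensional K E ∧
      E.fixingSubgroup.comap (absoluteGaloisGroup.toAlgEquiv K).toMonoidHom = N := by
  have hc : IsClosed (N : Set (absoluteGaloisGroup K)) := N.isClosed_of_isOpen hN
  let N' : ClosedSubgroup (AlgebraicClosure K ≃ₐ[K] AlgebraicClosure K) :=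
    ⟨(N : Subgroup (AlgebraicClosure K ≃ₐ[K] AlgebraicClosure K)), hc⟩
  have hfix : (IntermediateField.fixedField N'.1).fixingSubgroup = N'.1 :=
    InfiniteGalois.fixingSubgroup_fixedField N'
  refine ⟨IntermediateField.fixedField N'.1, ?_, ?_⟩
  · rw [← InfiniteGalois.isOpen_iff_finite, hfix]
    exact hN
  · rw [hfix]
    ext σ
    exact Iff.rfl

/-- KUMMER STEP: for `σ ∈ Gal(K̄/K)` commuting with `Gal(K̄/M)` and `n ≥ 1`, there is `m ∈ ℤ`
with `σ(a) = βⁿ · a^m`, `β ∈ M^×`, for all `a ∈ M^×`. [folklore] -/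
private theorem exists_int_forall_sigma_eq_dt (M : IntermediateField K (AlgebraicClosure K))
    (σ : AlgebraicClosure K ≃ₐ[K] AlgebraicClosure K)
    (hσ : ∀ τ ∈ M.fixingSubgroup, ∀ y : AlgebraicClosure K, τ (σ y) = σ (τ y))
    {n : ℕ} (hn : 0 < n) :
    ∃ m : ℤ, ∀ a : AlgebraicClosure K, a ∈ M → a ≠ 0 →
      ∃ β : AlgebraicClosure K, β ∈ M ∧ β ≠ 0 ∧ σ a = β ^ n * a ^ m := by
  haveI : NeZero n := ⟨hn.ne'⟩
  obtain ⟨m, hm⟩ := rootsOfUnity.integer_power_of_ringEquiv n (σ : AlgebraicClosure K ≃+* _)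
  refine ⟨m, fun a haM ha0 => ?_⟩
  obtain ⟨α, hα⟩ := IsAlgClosed.exists_pow_nat_eq a hn
  have hα0 : α ≠ 0 := by
    rintro rfl
    rw [zero_pow hn.ne'] at hα
    exact ha0 hα.symm
  set β : AlgebraicClosure K := σ α / α ^ m with hβdef
  have hβ0 : β ≠ 0 := by
    rw [hβdef]
    exact div_ne_zero ((map_ne_zero σ).mpr hα0) (zpow_ne_zero _ hα0)
  have hβM : β ∈ M := by
    rw [← InfiniteGalois.fixedField_fixingSubgroup M, IntermediateField.mem_fixedField_iff]
    intro τ hτ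
    have hτa : τ a = a := (IntermediateField.mem_fixingSubgroup_iff _ _).mp hτ a haM
    have hζn : (τ α / α) ^ n = 1 := by
      rw [div_pow, ← map_pow, hα, hτa, div_self ha0]
    have hζ0 : τ α / α ≠ 0 := div_ne_zero ((map_ne_zero τ).mpr hα0) hα0
    set ζu : (AlgebraicClosure K)ˣ := Units.mk0 (τ α / α) hζ0 with hζu
    have hζmem : ζu ∈ rootsOfUnity n (AlgebraicClosure K) := by
      rw [mem_rootsOfUnity]
      exact Units.ext (by simp [hζu, hζn])
    have hσζ : σ (τ α / α) = (τ α / α) ^ m := by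
      have := hm ⟨ζu, hζmem⟩
      simpa [hζu, Units.val_zpow_eq_zpow_val] using this
    have hτα : τ α = (τ α / α) * α := by rw [div_mul_cancel₀ _ hα0]
    rw [hβdef, map_div₀, map_zpow₀, hσ τ hτ α, hτα, map_mul, hσζ, mul_zpow]
    field_simp
  refine ⟨β, hβM, hβ0, ?_⟩
  have hσα : σ α = β * α ^ m := by rw [hβdef, div_mul_cancel₀ _ (zpow_ne_zero _ hα0)]
  calc σ a = σ (α ^ n) := by rw [hα]
    _ = (β * α ^ m) ^ n := by rw [map_pow, hσα]
    _ = β ^ n * (α ^ n) ^ m := by rw [mul_pow, ← zpow_natCast (α ^ m), ← zpow_mul, mul_comm m,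
        zpow_mul, zpow_natCast]
    _ = β ^ n * a ^ m := by rw [hα]

end General

/-- **Slimness from "infinitely divisible ⟹ finite order" and per-extension valuations**
(the class-field-theory-free engine for [Tpcs] Lem 4.14).  Let `K` have characteristic `0` and
`a₀ ∈ K^×`.  Suppose that for every finite subextension `M` of `K̄/K`: (1) there is a homomorphism
`v : M^× → ℤ` with `v(a₀) ≠ 0`; (2) every unit of `M` that is an `N`-th power for all `N ≥ 1` has
finite order.  Then `Gal(K̄/K)` is slim (every open subgroup has trivial centraliser).
[cite: MochizukiTopics2003, Lem 4.14 p.48] -/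
theorem isSlimGroup_absoluteGaloisGroup_of_divisible_isOfFinOrder {K : Type u} [Field K]
    [CharZero K] (a₀ : K) (ha₀ : a₀ ≠ 0)
    (hv : ∀ M : IntermediateField K (AlgebraicClosure K), FiniteDimensional K M →
      ∃ v : (M : Type u)ˣ →* Multiplicative ℤ,
        v (Units.mk0 (algebraMap K M a₀) ((map_ne_zero _).mpr ha₀)) ≠ 1)
    (hD : ∀ M : IntermediateField K (AlgebraicClosure K), FiniteDimensional K M →
      ∀ u : (M : Type u)ˣ, (∀ N : ℕ, 0 < N → ∃ b : (M : Type u)ˣ, b ^ N = u) → IsOfFinOrder u) :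
    IsSlimGroup (absoluteGaloisGroup K) := by
  haveI : Algebra.IsAlgebraic K (AlgebraicClosure K) := AlgebraicClosure.isAlgebraic K
  refine ⟨fun U hU => ?_⟩
  rw [eq_bot_iff]
  intro σ hσ
  rw [Subgroup.mem_centralizer_iff] at hσ
  rw [Subgroup.mem_bot]
  set σ' : AlgebraicClosure K ≃ₐ[K] AlgebraicClosure K :=
    absoluteGaloisGroup.toAlgEquiv K σ with hσ'
  suffices hfix : ∀ x : AlgebraicClosure K, σ' x = x by
    apply (absoluteGaloisGroup.toAlgEquiv K).injective
    rw [map_one]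
    exact AlgEquiv.ext hfix
  obtain ⟨E₀, hE₀fin, hE₀U⟩ := exists_intermediateField_of_isOpen_dt U hU
  haveI := hE₀fin
  -- it suffices to show that `σ' x / x` is a root of unity for every `x ≠ 0`
  refine Literature.FieldTheory.Galois.eq_self_of_forall_pow_eq (σ' : AlgebraicClosure K →+* _)
    fun x hx0 => ?_
  change ∃ n : ℕ, 0 < n ∧ σ' x ^ n = x ^ n
  haveI : FiniteDimensional K K⟮x⟯ :=
    IntermediateField.adjoin.finiteDimensional (Algebra.IsIntegral.isIntegral x)
  set M : IntermediateField K (AlgebraicClosure K) := E₀ ⊔ K⟮x⟯ with hMdef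
  haveI hMfin : FiniteDimensional K M := IntermediateField.finiteDimensional_sup E₀ K⟮x⟯
  have hxM : x ∈ M := (le_sup_right : K⟮x⟯ ≤ M) (IntermediateField.mem_adjoin_simple_self K x)
  have hcomm : ∀ τ ∈ M.fixingSubgroup, ∀ y : AlgebraicClosure K, τ (σ' y) = σ' (τ y) := by
    intro τ hτ y
    have hτE₀ : τ ∈ E₀.fixingSubgroup := by
      rw [IntermediateField.mem_fixingSubgroup_iff] at hτ ⊢
      exact fun z hz => hτ z ((le_sup_left : E₀ ≤ M) hz)
    have hτU : (absoluteGaloisGroup.toAlgEquiv K).symm τ ∈ U := by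
      rw [← hE₀U]
      exact hτE₀
    have h := hσ _ hτU
    have h' := congrArg (fun g => absoluteGaloisGroup.toAlgEquiv K g y) h
    simpa [hσ', AlgEquiv.mul_apply] using h'
  have hσxM : σ' x ∈ M := by
    rw [← InfiniteGalois.fixedField_fixingSubgroup M, IntermediateField.mem_fixedField_iff]
    intro τ hτ
    rw [hcomm τ hτ x, (IntermediateField.mem_fixingSubgroup_iff _ _).mp hτ x hxM]
  -- the homomorphism `v : M^× → ℤ` with `v(a₀) ≠ 0`
  obtain ⟨v, hva₀⟩ := hv M hMfin
  let ν : (M : Type u)ˣ → ℤ := fun y => Multiplicative.toAdd (v y)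
  have hνmul : ∀ y z : (M : Type u)ˣ, ν (y * z) = ν y + ν z := fun y z => by
    simp only [ν, map_mul, toAdd_mul]
  have hνpow : ∀ (y : (M : Type u)ˣ) (k : ℕ), ν (y ^ k) = k * ν y := fun y k => by
    simp only [ν, map_pow, toAdd_pow, nsmul_eq_mul]
  have hνzpow : ∀ (y : (M : Type u)ˣ) (k : ℤ), ν (y ^ k) = k * ν y := fun y k => by
    simp only [ν, map_zpow, toAdd_zpow, zsmul_eq_mul, Int.cast_id]
  set aM : M := algebraMap K M a₀ with haMdef
  have haM0 : aM ≠ 0 := (map_ne_zero _).mpr ha₀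
  set aU : (M : Type u)ˣ := Units.mk0 aM haM0 with haUdef
  have hνa₀ : ν aU ≠ 0 := by
    intro h
    apply hva₀
    simpa [ν] using congrArg Multiplicative.ofAdd h
  set c : ℕ := (ν aU).natAbs with hcdef
  have hc : 0 < c := Int.natAbs_pos.mpr hνa₀
  -- the unit `u := σ x / x` of `M`
  have hσx0 : σ' x ≠ 0 := (map_ne_zero σ').mpr hx0
  set xM : M := ⟨x, hxM⟩ with hxMdef
  set sxM : M := ⟨σ' x, hσxM⟩ with hsxMdef
  have hxM0 : xM ≠ 0 := fun h => hx0 (congrArg Subtype.val h)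
  have hsxM0 : sxM ≠ 0 := fun h => hσx0 (congrArg Subtype.val h)
  set u : (M : Type u)ˣ := Units.mk0 sxM hsxM0 / Units.mk0 xM hxM0 with hudef
  have hdiv : ∀ N : ℕ, 0 < N → ∃ b : (M : Type u)ˣ, b ^ N = u := by
    intro N hN
    have hn : 0 < N * c := Nat.mul_pos hN hc
    obtain ⟨m, hm⟩ := exists_int_forall_sigma_eq_dt M σ' hcomm hn
    -- Step (2): `a₀ ∈ K` is fixed by `σ`, which pins down `m` modulo `N`
    set aΩ : AlgebraicClosure K := algebraMap K (AlgebraicClosure K) a₀ with haΩdef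
    have haΩM : aΩ ∈ M := M.algebraMap_mem _
    have haΩ0 : aΩ ≠ 0 := by
      rw [haΩdef, map_ne_zero]
      exact ha₀
    obtain ⟨β, hβM, hβ0, hσa⟩ := hm aΩ haΩM haΩ0
    rw [haΩdef, AlgEquiv.commutes] at hσa
    -- as units of `M`: `aU = βU ^ n * aU ^ m`
    set βM : M := ⟨β, hβM⟩ with hβMdef
    have hβM0 : βM ≠ 0 := fun h => hβ0 (congrArg Subtype.val h)
    set βU : (M : Type u)ˣ := Units.mk0 βM hβM0 with hβUdef
    have hUeq : aU = βU ^ (N * c) * aU ^ m := by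
      apply Units.ext
      apply (algebraMap M (AlgebraicClosure K)).injective
      rw [Units.val_mul, Units.val_pow_eq_pow_val, Units.val_zpow_eq_zpow_val, map_mul, map_pow,
        map_zpow₀]
      exact hσa
    -- apply `ν`
    have hνeq : ν aU = (N * c : ℕ) * ν βU + m * ν aU := by
      have := congrArg ν hUeq
      rw [hνmul, hνpow, hνzpow] at this
      exact_mod_cast this
    -- solve for `m`: `m = 1 + N * t`
    have hm1 : ∃ t : ℤ, m = 1 + N * t := by
      have hsc : ν aU = c ∨ ν aU = -c := by
        rcases Int.natAbs_eq (ν aU) with h | h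
        · left; rw [← hcdef] at h; exact h
        · right; rw [← hcdef] at h; exact h
      have hc0 : (c : ℤ) ≠ 0 := by exact_mod_cast hc.ne'
      push_cast at hνeq
      rcases hsc with h | h
      · refine ⟨-ν βU, ?_⟩
        rw [h] at hνeq
        have : (c : ℤ) * (1 - m - N * ν βU) = 0 := by linear_combination hνeq
        rcases mul_eq_zero.mp this with h1 | h1
        · exact absurd h1 hc0
        · linarith
      · refine ⟨ν βU, ?_⟩
        rw [h] at hνeq
        have : (c : ℤ) * (m - 1 - N * ν βU) = 0 := by linear_combination hνeq
        rcases mul_eq_zero.mp this with h1 | h1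
        · exact absurd h1 hc0
        · linarith
    obtain ⟨t, ht⟩ := hm1
    -- Step (1) for `a = x`
    obtain ⟨β', hβ'M, hβ'0, hσxeq⟩ := hm x hxM hx0
    have hb0 : (⟨β' ^ c * x ^ t, mul_mem (pow_mem hβ'M _) (zpow_mem hxM t)⟩ : M) ≠ 0 := by
      intro h
      have := congrArg Subtype.val h
      exact mul_ne_zero (pow_ne_zero _ hβ'0) (zpow_ne_zero _ hx0) this
    refine ⟨Units.mk0 _ hb0, ?_⟩
    apply Units.ext
    apply Subtype.ext
    change (β' ^ c * x ^ t) ^ N = σ' x / x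
    rw [hσxeq, ht, eq_div_iff hx0, mul_pow, ← pow_mul, mul_comm c N, ← zpow_natCast (x ^ t),
      ← zpow_mul]
    rw [show x ^ (1 + (N : ℤ) * t) = x * x ^ (t * (N : ℤ)) by
      rw [← zpow_one_add₀ hx0]; ring_nf]
    ring
  -- `u` has finite order `k`: `σ x ^ k = x ^ k`
  obtain ⟨k, hk, hku⟩ := (hD M hMfin u hdiv).exists_pow_eq_one
  refine ⟨k, hk, ?_⟩
  have := congrArg (fun w : (M : Type u)ˣ => ((w : M) : AlgebraicClosure K)) hku
  simp only [hudef, div_pow, Units.val_div_eq_div_val, Units.val_pow_eq_pow_val, Units.val_mk0,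
    Units.val_one] at this
  have hval : (((sxM ^ k / xM ^ k : M)) : AlgebraicClosure K) = σ' x ^ k / x ^ k := rfl
  rw [hval] at this
  simpa [div_eq_one_iff_eq (pow_ne_zero k hx0)] using this

/-- Center-freeness under the same hypotheses. [cite: MochizukiTopics2003, Lem 4.14 p.48] -/
theorem center_absoluteGaloisGroup_eq_bot_of_divisible_isOfFinOrder {K : Type u} [Field K]
    [CharZero K] (a₀ : K) (ha₀ : a₀ ≠ 0)
    (hv : ∀ M : IntermediateField K (AlgebraicClosure K), FiniteDimensional K M →
      ∃ v : (M : Type u)ˣ →* Multiplicative ℤ,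
        v (Units.mk0 (algebraMap K M a₀) ((map_ne_zero _).mpr ha₀)) ≠ 1)
    (hD : ∀ M : IntermediateField K (AlgebraicClosure K), FiniteDimensional K M →
      ∀ u : (M : Type u)ˣ, (∀ N : ℕ, 0 < N → ∃ b : (M : Type u)ˣ, b ^ N = u) → IsOfFinOrder u) :
    Subgroup.center (absoluteGaloisGroup K) = ⊥ := by
  have h := (isSlimGroup_absoluteGaloisGroup_of_divisible_isOfFinOrder a₀ ha₀ hv hD).centralizer_eq_bot
    ⊤ isOpen_univ
  rw [eq_bot_iff] at h ⊢
  intro z hz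
  refine h ?_
  rw [Subgroup.mem_centralizer_iff]
  intro g _
  exact ((Subgroup.mem_center_iff.mp hz) g)

end Literature.AnabelianGeometry.AbsoluteAnabelian
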